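import Summits.AtomisticToContinuum.HydrodynamicLimit.Theorems.InformationPercolationEngineKickFairRelEquilibriumMesoDefs
import Summits.AtomisticToContinuum.HydrodynamicLimit.Theorems.KickFairRelEquilibriumMeso.Negative.WindowAlgebra

/-!
# Crux-ideate r2 / ideator 4 — `condition-the-past` (crux stmt-AtomisticToContinuum-15177,
`InformationPercolationEngine.KickFairRelEquilibriumMeso`)

First lemmas of the card `Ideas/condition-the-past.md`:

* §1 `integral_mul_sub_condExp_eq` / `abs_integral_mul_sub_condExp_le` (PROVED): the conditioned
  cross term — for σ-algebras `m ≤ mA`, a bounded `mA`-measurable weight `Y` and an integrable kick `D`,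
  `∫ Y (D − μ[D|m]) = ∫ Y (μ[D|mA] − μ[D|m])`, hence `|∫ Y (D − μ[D|m])| ≤ C ∫ |μ[D|mA] − μ[D|m]|`.
  This is what turns every time-ORDERED cross term of `E_{LG} S_h²` into a one-collision-ENRICHED
  conditional bias (first moment), with no decorrelation / concentration input.
* §2 `abs_integral_mul_comp_sub_le` (PROVED): the quasi-invariance bound — for a measure-preserving
  equivalence `T` and a weight `W ≥ 0`, `|∫ W (D∘T − D)| ≤ C ∫ |W∘T⁻¹ − W|`: the backward-weight lever
  (fibre-preserving chain shifts) behind the EARLY-TIME theorem.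
* §3 typed crux-level objects over the landed line vocabulary `KickFairRelEquilibriumMesoLine`
  (`past`, `kick`, `kappa`, `cnt`): the LG-conditional bias `betaLG`, the enriched bias `betaLG2`, and the
  three statements `SingleKickBias`, `RobustKickBias` (pair-Campbell, time-ordered), `KickFairEarly`
  (the crux's body restricted to weights supported on collisions before `K · t_N`).
-/

noncomputable section

open MeasureTheory Set Filter Topology
open scoped ENNReal Classical

namespace Summit.AtomisticToContinuum.HydrodynamicLimit.Cruxes.KickFairRelEquilibriumMeso.ConditionThePast

/-! ## §1 The conditioned cross term (abstract probability) -/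

section Abstract

variable {Ω : Type*} {m mA m0 : MeasurableSpace Ω} {μ : Measure[m0] Ω}

/-- **Conditioned cross term.** If `m ≤ mA ≤ m0`, `Y` is `mA`-strongly measurable and bounded and `D` is
integrable, then `∫ Y·(D − μ[D|m]) = ∫ Y·(μ[D|mA] − μ[D|m])`. [folklore] -/
theorem integral_mul_sub_condExp_eq [IsFiniteMeasure μ] (hm : m ≤ mA) (hA : mA ≤ m0)
    {Y D : Ω → ℝ} (hY : StronglyMeasurable[mA] Y) {C : ℝ} (hYb : ∀ ω, |Y ω| ≤ C)
    (hD : Integrable D μ) :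
    ∫ ω, Y ω * (D ω - (μ[D|m]) ω) ∂μ = ∫ ω, Y ω * ((μ[D|mA]) ω - (μ[D|m]) ω) ∂μ := by
  have hYm0 : AEStronglyMeasurable Y μ := (hY.mono hA).aestronglyMeasurable
  have hYD : Integrable (Y * D) μ := by
    refine Integrable.bdd_mul' (c := C) hD hYm0 (Filter.Eventually.of_forall fun ω => ?_)
    simpa [Real.norm_eq_abs] using hYb ω
  have hYcA : Integrable (fun ω => Y ω * (μ[D|mA]) ω) μ := by
    refine Integrable.bdd_mul' (c := C) integrable_condExp hYm0 (Filter.Eventually.of_forall fun ω => ?_)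
    simpa [Real.norm_eq_abs] using hYb ω
  have hYcm : Integrable (fun ω => Y ω * (μ[D|m]) ω) μ := by
    refine Integrable.bdd_mul' (c := C) integrable_condExp hYm0 (Filter.Eventually.of_forall fun ω => ?_)
    simpa [Real.norm_eq_abs] using hYb ω
  -- key identity: ∫ Y D = ∫ Y μ[D|mA]
  have key : ∫ ω, Y ω * D ω ∂μ = ∫ ω, Y ω * (μ[D|mA]) ω ∂μ := by
    have h1 : μ[Y * D|mA] =ᵐ[μ] Y * μ[D|mA] := condExp_mul_of_stronglyMeasurable_left hY hYD hD
    have h2 : ∫ ω, (μ[Y * D|mA]) ω ∂μ = ∫ ω, (Y * D) ω ∂μ := integral_condExp hA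
    calc ∫ ω, Y ω * D ω ∂μ = ∫ ω, (Y * D) ω ∂μ := rfl
      _ = ∫ ω, (μ[Y * D|mA]) ω ∂μ := h2.symm
      _ = ∫ ω, (Y * μ[D|mA]) ω ∂μ := integral_congr_ae h1
      _ = ∫ ω, Y ω * (μ[D|mA]) ω ∂μ := rfl
  have hYD' : Integrable (fun ω => Y ω * D ω) μ := hYD
  simp_rw [mul_sub]
  rw [integral_sub hYD' hYcm, integral_sub hYcA hYcm, key]

/-- **Bound on a conditioned cross term**: `|∫ Y (D − μ[D|m])| ≤ C · ∫ |μ[D|mA] − μ[D|m]|`. [folklore] -/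
theorem abs_integral_mul_sub_condExp_le [IsFiniteMeasure μ] (hm : m ≤ mA) (hA : mA ≤ m0)
    {Y D : Ω → ℝ} (hY : StronglyMeasurable[mA] Y) {C : ℝ} (hYb : ∀ ω, |Y ω| ≤ C)
    (hD : Integrable D μ) :
    |∫ ω, Y ω * (D ω - (μ[D|m]) ω) ∂μ| ≤ C * ∫ ω, |(μ[D|mA]) ω - (μ[D|m]) ω| ∂μ := by
  rw [integral_mul_sub_condExp_eq hm hA hY hYb hD]
  calc |∫ ω, Y ω * ((μ[D|mA]) ω - (μ[D|m]) ω) ∂μ|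
      ≤ ∫ ω, |Y ω * ((μ[D|mA]) ω - (μ[D|m]) ω)| ∂μ := by
        simpa [Real.norm_eq_abs] using norm_integral_le_integral_norm (fun ω => Y ω * ((μ[D|mA]) ω - (μ[D|m]) ω))
    _ ≤ ∫ ω, C * |(μ[D|mA]) ω - (μ[D|m]) ω| ∂μ := by
        refine integral_mono_of_nonneg (Filter.Eventually.of_forall fun ω => abs_nonneg _) ?_ ?_
        · exact ((integrable_condExp.sub integrable_condExp).abs.const_mul C)
        · exact Filter.Eventually.of_forall fun ω => by
            show |Y ω * ((μ[D|mA]) ω - (μ[D|m]) ω)| ≤ C * |(μ[D|mA]) ω - (μ[D|m]) ω|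
            rw [abs_mul]
            exact mul_le_mul_of_nonneg_right (hYb ω) (abs_nonneg _)
    _ = C * ∫ ω, |(μ[D|mA]) ω - (μ[D|m]) ω| ∂μ := integral_const_mul C _

end Abstract

/-! ## §2 The quasi-invariance bound (measure-preserving fibre shifts) -/

section QuasiInvariance

variable {Ω : Type*} [MeasurableSpace Ω] {μ : Measure Ω}

/-- **Quasi-invariance bound.** For a measure-preserving measurable equivalence `T` of `(Ω, μ)`, a weight
`W` and a bounded observable `D` with the needed integrability,
`|∫ W·(D∘T − D) dμ| ≤ C ∫ |W∘T⁻¹ − W| dμ`. With `μ = G` (invariant law), `W = dLG/dG` and `T` a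
fibre-preserving chain shift this reads: the LG-bias of a kick is controlled by the LG-quasi-invariance
`E_{LG}|W∘T⁻¹/W − 1|` under the shift. [folklore] -/
theorem abs_integral_mul_comp_sub_le (T : Ω ≃ᵐ Ω) (hT : MeasurePreserving T μ μ)
    {W D : Ω → ℝ} {C : ℝ} (hDb : ∀ ω, |D ω| ≤ C) (hD : Measurable D)
    (hWD : Integrable (fun ω => W ω * D (T ω)) μ) (hWD' : Integrable (fun ω => W ω * D ω) μ)
    (hWT : Integrable (fun ω => W (T.symm ω)) μ) (hW : Integrable W μ) :
    |∫ ω, W ω * (D (T ω) - D ω) ∂μ| ≤ C * ∫ ω, |W (T.symm ω) - W ω| ∂μ := by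
  -- change of variables: ∫ W · D∘T dμ = ∫ (W∘T⁻¹) · D dμ
  have hcv : ∫ ω, W ω * D (T ω) ∂μ = ∫ ω, W (T.symm ω) * D ω ∂μ := by
    have := (MeasurePreserving.symm T hT).integral_comp' (f := T.symm) (g := fun ω => W ω * D (T ω))
    -- `integral_comp'` : ∫ g (T.symm ω) dμ = ∫ g dμ
    simp only [MeasurableEquiv.apply_symm_apply] at this
    exact this.symm
  have hsplit : ∫ ω, W ω * (D (T ω) - D ω) ∂μ = ∫ ω, (W (T.symm ω) - W ω) * D ω ∂μ := by
    simp_rw [mul_sub, sub_mul]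
    have hi : Integrable (fun ω => W (T.symm ω) * D ω) μ := by
      have h0 := Integrable.bdd_mul' (c := C) hWT hD.aestronglyMeasurable
        (Filter.Eventually.of_forall fun ω => by simpa [Real.norm_eq_abs] using hDb ω)
      exact h0.congr (Filter.Eventually.of_forall fun ω => mul_comm _ _)
    rw [integral_sub hWD hWD', integral_sub hi hWD', hcv]
  rw [hsplit]
  calc |∫ ω, (W (T.symm ω) - W ω) * D ω ∂μ|
      ≤ ∫ ω, |(W (T.symm ω) - W ω) * D ω| ∂μ := by
        simpa [Real.norm_eq_abs] using norm_integral_le_integral_norm (fun ω => (W (T.symm ω) - W ω) * D ω)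
    _ ≤ ∫ ω, C * |W (T.symm ω) - W ω| ∂μ := by
        refine integral_mono_of_nonneg (Filter.Eventually.of_forall fun ω => abs_nonneg _) ?_ ?_
        · exact (hWT.sub hW).abs.const_mul C
        · exact Filter.Eventually.of_forall fun ω => by
            show |(W (T.symm ω) - W ω) * D ω| ≤ C * |W (T.symm ω) - W ω|
            rw [abs_mul, mul_comm]
            exact mul_le_mul_of_nonneg_right (hDb ω) (abs_nonneg _)
    _ = C * ∫ ω, |W (T.symm ω) - W ω| ∂μ := integral_const_mul C _

end QuasiInvariance

/-! ## §3 Typed crux-level objects (over the landed line vocabulary) -/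

open Literature.Analysis.FluidPDE Literature.MathematicalPhysics.KineticTheory
open Summit.AtomisticToContinuum.HydrodynamicLimit.Theorems.KickFairRelEquilibriumMesoLine
  (Past Phase Flow cnt past kick kappa tN)
open Summit.AtomisticToContinuum.HydrodynamicLimit.Theorems.KickFairRelEquilibriumMesoNegative
  (KickBoundRel LowerEdge)

/-- The compensated kick `D_{i,n} = g(X_{i,n}) − κ_{i,n}` (κ under the INVARIANT law, verbatim the crux's). -/
def kickDev {σ : ℝ} {N : ℕ} (Φ : Flow σ N) (r : ℝ) (g : V3 × V3 × V3 → ℝ) (i : Fin (N + 1)) (n : ℕ)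
    (z : Phase N) : ℝ :=
  g (kick Φ i n z) - kappa Φ r g i n z

/-- **The LG-conditional bias** `β_{i,n} := E_{LG}[D_{i,n} | σ(P_{i,n})]` — conditional expectation under the
NON-equilibrium local Gibbs law of the data, given the comap σ-algebra of the typed past (h-free). -/
def betaLG (σ : ℝ) (a₀ θ₀ : T3 → ℝ) (u₀ : T3 → V3) {N : ℕ} (Φ : Flow σ N) (r : ℝ)
    (g : V3 × V3 × V3 → ℝ) (i : Fin (N + 1)) (n : ℕ) : Phase N → ℝ :=
  MeasureTheory.condExp (MeasurableSpace.comap (fun z => past Φ r z i n) inferInstance)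
    (localGibbsLaw σ a₀ u₀ θ₀ N Φ) (kickDev Φ r g i n)

/-- **The one-collision-enriched LG-conditional bias** of the kick `(i', n')` given ITS typed past joined with
the typed past AND the compensated outcome of another collision `(i, n)`:
`β₂ := E_{LG}[D_{i',n'} | σ(P_{i',n'}, P_{i,n}, D_{i,n})]`. -/
def betaLG2 (σ : ℝ) (a₀ θ₀ : T3 → ℝ) (u₀ : T3 → V3) {N : ℕ} (Φ : Flow σ N) (r : ℝ)
    (g : V3 × V3 × V3 → ℝ) (i : Fin (N + 1)) (n : ℕ) (i' : Fin (N + 1)) (n' : ℕ) : Phase N → ℝ :=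
  MeasureTheory.condExp
    (MeasurableSpace.comap (fun z => (past Φ r z i' n', past Φ r z i n, kickDev Φ r g i n z)) inferInstance)
    (localGibbsLaw σ a₀ u₀ θ₀ N Φ) (kickDev Φ r g i' n')

/-- Time ordering `(i,n) ≺ (i',n')`: the collision time of `(i,n)` precedes BOTH photo times (flight starts)
of `(i',n')` — read off the typed pasts (coordinates `.2.2.2` = collision time, `.2.1`, `.2.2.1` = the two
flight starts). -/
def Precedes {N : ℕ} (p p' : Past N) : Prop :=
  p.2.2.2 < p'.2.1 ∧ p.2.2.2 < p'.2.2.1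

/-- **B1 — single-kick conditional bias (Campbell-L¹).** Along the cell sequence `rs`: for continuous positive
profiles, `∃ σ₀ ∀ σ < σ₀ ∀ Φ τ g δ ∃ N₀ ∀ N ≥ N₀`,
`E_{LG}[(ε/(N+1)) Σ_i Σ_{n < cnt_i} |β_{i,n}|] ≤ δ`. NECESSARY for the crux (take `h = sign β`). -/
def SingleKickBias (rs : ℕ → ℝ) : Prop :=
  ∀ (a₀ θ₀ : T3 → ℝ) (u₀ : T3 → V3), Continuous a₀ → Continuous θ₀ → Continuous u₀ →
    (∀ x, 0 < a₀ x) → (∀ x, 0 < θ₀ x) → ∃ σ₀ : ℝ, 0 < σ₀ ∧ ∀ σ : ℝ, 0 < σ → σ < σ₀ →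
    ∀ Φ : (N : ℕ) → Flow σ N, ∀ τ : ℝ, 0 < τ →
    ∀ g : V3 × V3 × V3 → ℝ, Continuous g → (∃ C : ℝ, ∀ p, |g p| ≤ C) →
    ∀ δ : ℝ, 0 < δ → ∃ N₀ : ℕ, ∀ N : ℕ, N₀ ≤ N →
    ∫⁻ z, ENNReal.ofReal (hsDiameter σ N / ((N : ℝ) + 1) *
        ∑ i : Fin (N + 1), ∑ n ∈ Finset.range (cnt (Φ N) τ z i),
          |betaLG σ a₀ θ₀ u₀ (Φ N) (rs N) g i n z|) ∂(localGibbsLaw σ a₀ u₀ θ₀ N (Φ N)) ≤ ENNReal.ofReal δ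

/-- **B2 — robust (one-collision-enriched) conditional bias over time-ORDERED pairs (pair-Campbell-L¹).**
`E_{LG}[(ε/(N+1))² Σ_{(i,n)} Σ_{(i',n')} 1_{(i,n) ≺ (i',n')} |β₂_{(i,n)→(i',n')}|] ≤ δ` eventually.
This is what the conditioned cross terms of `E_{LG} S_h²` reduce to (§1); dynamically-linked pairs
(recollision rings, shared partners) number `O(#collisions)` and are absorbed by the `ε/(N+1)` prefactor. -/
def RobustKickBias (rs : ℕ → ℝ) : Prop :=
  ∀ (a₀ θ₀ : T3 → ℝ) (u₀ : T3 → V3), Continuous a₀ → Continuous θ₀ → Continuous u₀ →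
    (∀ x, 0 < a₀ x) → (∀ x, 0 < θ₀ x) → ∃ σ₀ : ℝ, 0 < σ₀ ∧ ∀ σ : ℝ, 0 < σ → σ < σ₀ →
    ∀ Φ : (N : ℕ) → Flow σ N, ∀ τ : ℝ, 0 < τ →
    ∀ g : V3 × V3 × V3 → ℝ, Continuous g → (∃ C : ℝ, ∀ p, |g p| ≤ C) →
    ∀ δ : ℝ, 0 < δ → ∃ N₀ : ℕ, ∀ N : ℕ, N₀ ≤ N →
    ∫⁻ z, ENNReal.ofReal ((hsDiameter σ N / ((N : ℝ) + 1)) ^ 2 *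
        ∑ i : Fin (N + 1), ∑ n ∈ Finset.range (cnt (Φ N) τ z i),
          ∑ i' : Fin (N + 1), ∑ n' ∈ Finset.range (cnt (Φ N) τ z i'),
            (if Precedes (past (Φ N) (rs N) z i n) (past (Φ N) (rs N) z i' n') then (1 : ℝ) else 0) *
              |betaLG2 σ a₀ θ₀ u₀ (Φ N) (rs N) g i n i' n' z|) ∂(localGibbsLaw σ a₀ u₀ θ₀ N (Φ N))
      ≤ ENNReal.ofReal δ

/-- **EARLY KICK FAIRNESS (the provable-now special case of the crux).** The crux's body along `rs`,
restricted to admissible weights `h` SUPPORTED ON COLLISIONS BEFORE `K · t_N` (`K` mean-free-time units):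
`h i n p = 0` whenever `K · t_N < t_{i,n} = p.2.2.2`. Implied by the crux (a sub-family of its weights);
claimed provable WITHOUT any equilibrium dynamical input by the backward-weight lever (§2): cone confinement +
local conservation make `dLG/dG` quasi-invariant under the fibre-preserving chain shifts for `t ≤ K t_N`. -/
def KickFairEarly (rs : ℕ → ℝ) (K : ℝ) : Prop :=
  ∀ (a₀ θ₀ : T3 → ℝ) (u₀ : T3 → V3), Continuous a₀ → Continuous θ₀ → Continuous u₀ →
    (∀ x, 0 < a₀ x) → (∀ x, 0 < θ₀ x) → ∃ σ₀ : ℝ, 0 < σ₀ ∧ ∀ σ : ℝ, 0 < σ → σ < σ₀ →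
    ∀ Φ : (N : ℕ) → Flow σ N, ∀ τ : ℝ, 0 < τ →
    ∀ g : V3 × V3 × V3 → ℝ, Continuous g → (∃ C : ℝ, ∀ p, |g p| ≤ C) →
    ∀ δ : ℝ, 0 < δ → ∃ N₀ : ℕ, ∀ N : ℕ, N₀ ≤ N →
    ∀ h : Fin (N + 1) → ℕ → Past N → ℝ, (∀ i n, Measurable (h i n)) →
    (∀ i n p, |h i n p| ≤ 1) → (∀ i n p, K * tN N < p.2.2.2 → h i n p = 0) →
    KickBoundRel σ a₀ θ₀ u₀ N (Φ N) τ (rs N) g h δ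

/-- Sanity: the early statement is a special case of the crux's body (`MesoBody` restricted to a sub-family
of weights). [folklore] -/
theorem kickFairEarly_of_mesoBody {rs : ℕ → ℝ} (K : ℝ)
    (hB : Summit.AtomisticToContinuum.HydrodynamicLimit.Theorems.KickFairRelEquilibriumMesoNegative.MesoBody rs) :
    KickFairEarly rs K := by
  intro a₀ θ₀ u₀ ha hθ hu ha0 hθ0
  obtain ⟨σ₀, hσ₀, H⟩ := hB a₀ θ₀ u₀ ha hθ hu ha0 hθ0
  refine ⟨σ₀, hσ₀, fun σ hσ hσσ₀ Φ τ hτ g hg hgb δ hδ => ?_⟩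
  obtain ⟨N₀, hN₀⟩ := H σ hσ hσσ₀ Φ τ hτ g hg hgb δ hδ
  exact ⟨N₀, fun N hN h hhm hhb _ => hN₀ N hN h hhm hhb⟩

end Summit.AtomisticToContinuum.HydrodynamicLimit.Cruxes.KickFairRelEquilibriumMeso.ConditionThePast
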